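import Summits.CriticalPhenomena.PercolationContinuityZ3.Theorems.PercNearOneGluingNoHeavyLowerTailSuperTerminalQuarticDvec
import HarnessLib

/-!
# `V4` on a finite weighted graph follows from `V4` on its `{s,a,b,c}`-pieces (graph-level assembly of THEOREM A — "THEOREM B")

Support file for crux `stmt-CriticalPhenomena-4575` (`NoHeavyLowerTail`), seat `prim-l12-p1` gen 32 (`--supports stmt-CriticalPhenomena-4575`);
part 2 of 2 of the assembly of THEOREM A (part 1: `…SuperTerminalQuarticDvec`); spec `GRAPH-LEVEL-SPEC-g134.md` §4 (lead gen 134).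
No definitions, no sorries, standard axioms.

MAIN THEOREM (`superTerminalQuartic_of_pieces`).  For pairwise distinct `s a b c` and a splitting `part : V → ι` of `w` along `T₄ = {s,a,b,c}`
(non-terminal pairs across labels have weight `0`): **if the super-terminal quartic law `V4` — `μ(F ∩ I)⁴ ≤ μ(F ∩ IA)²·μ(F ∩ IB)²·μ(I)`,
`F = {s↔a}∩{s↮b}`, `I = c ∤ {s,a,b}`, `IA = c ∤ {s,a}`, `IB = {c↮b}` — holds for every piece as a weighted graph of its own
(`wᵢ := w·1_{pairs of piece i}`), then it holds for `w`.**  So a counterexample to `V4` with the fewest internal vertices is `{s,a,b,c}`-prime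
(lead gen 134 THEOREM B: "`V4` on all finite weighted graphs ⟺ `V4` on `{s,a,b,c}`-prime graphs").

PROOF.  Induction over sets `S` of pieces on the vector `D(w₀)·∏_{i∈S} D(wᵢ)`, which is the down-set vector of the partial union `w_S`
(`SuperTerminalP3LamDvec.real_partLE_partialUnion`) and therefore satisfies the order relations and the sextic law `(Q6)_c`
(`core_of_weight`, `SuperTerminalDownsets.sextic_law`); the step is `SuperTerminalQuarticDvec.dvec_quartic_mul` (= `quartic_stable`); the
terminal piece `w₀` by the same induction pair by pair (`v4_terminal`, `v4_single`); at `S = univ` the vector is `D(w)` by the splitting formula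
[BeicheltTittmann2012, Thm. 7.5] and `v4_iff` translates back.
-/

namespace Summit.CriticalPhenomena.PercolationContinuityZ3.Theorems.SuperTerminalQuarticGluing

open MeasureTheory Set
open Literature.Probability.Percolation Literature.Probability.Percolation.PartitionGluing
open Literature.Probability.LatticeModels (prodBernoulli)
open SuperTerminalDownsets SuperTerminalDownsetEvents SuperTerminalP3LamDvec SuperTerminalQuarticDvec
open scoped Classical

variable {V : Type*} [Fintype V]

/-- `V4` in down-set coordinates (as in `…SuperTerminalQuarticDvec`).  Local notation only. -/
local notation "V4row[" x0 "," x1 "," x2 "," x3 "," x4 "," x5 "," x6 "," x7 "]" =>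
  (((x1 - x0) ^ 4 ≤ (x2 - x3) ^ 2 * (x4 - x5 - x6 + x0) ^ 2 * x7) : Prop)

/-- The sextic law of every weight in down-set coordinates (`SuperTerminalDownsets.sextic_law`), under the name used in this file. [this work] -/
theorem sextic_of_weight {s a b c : V} (u : Sym2 V → unitInterval) (hd : s ≠ a ∧ s ≠ b ∧ s ≠ c ∧ a ≠ b ∧ a ≠ c ∧ b ≠ c) :
    (prodBernoulli u).real ((openConn s b)ᶜ ∩ (openConn s c)ᶜ ∩ (openConn a b)ᶜ ∩ (openConn a c)ᶜ ∩ (openConn b c)ᶜ) ^ 6 ≤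
      (prodBernoulli u).real ((openConn c s)ᶜ ∩ (openConn c a)ᶜ ∩ (openConn c b)ᶜ) ^ 2 *
        (prodBernoulli u).real ((openConn s b)ᶜ ∩ (openConn s c)ᶜ ∩ (openConn a b)ᶜ ∩ (openConn a c)ᶜ) ^ 3 *
          (prodBernoulli u).real ((openConn s b)ᶜ ∩ (openConn a b)ᶜ ∩ (openConn b c)ᶜ) ^ 3 :=
  sextic_law u hd

/-! ## The terminal piece and the assembly -/

section Pieces
variable {s a b c : V}

/-- **The terminal piece satisfies `V4`**: for `w₀ := w·1_{pairs of T₄}` (the graph `G⁰ = (T₄, terminal pairs)`, six arbitrary weights) `V4` holds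
in down-set coordinates — induction over the terminal pairs with `dvec_quartic_mul`, each one-pair graph satisfying `V4` (`v4_single`) and each
partial graph satisfying `(Q6)_c` (`sextic_law`). [this work] -/
theorem v4_terminal (w : Sym2 V → unitInterval) (hd : s ≠ a ∧ s ≠ b ∧ s ≠ c ∧ a ≠ b ∧ a ≠ c ∧ b ≠ c) :
    V4row[(prodBernoulli fun e => if e ∈ ({s, a, b, c} : Finset V).sym2 then w e else 0).real
        ((openConn s a)ᶜ ∩ (openConn s b)ᶜ ∩ (openConn s c)ᶜ ∩ (openConn a b)ᶜ ∩ (openConn a c)ᶜ ∩ (openConn b c)ᶜ),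
      (prodBernoulli fun e => if e ∈ ({s, a, b, c} : Finset V).sym2 then w e else 0).real
        ((openConn s b)ᶜ ∩ (openConn s c)ᶜ ∩ (openConn a b)ᶜ ∩ (openConn a c)ᶜ ∩ (openConn b c)ᶜ),
      (prodBernoulli fun e => if e ∈ ({s, a, b, c} : Finset V).sym2 then w e else 0).real
        ((openConn s b)ᶜ ∩ (openConn s c)ᶜ ∩ (openConn a b)ᶜ ∩ (openConn a c)ᶜ),
      (prodBernoulli fun e => if e ∈ ({s, a, b, c} : Finset V).sym2 then w e else 0).real
        ((openConn s a)ᶜ ∩ (openConn s b)ᶜ ∩ (openConn s c)ᶜ ∩ (openConn a b)ᶜ ∩ (openConn a c)ᶜ),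
      (prodBernoulli fun e => if e ∈ ({s, a, b, c} : Finset V).sym2 then w e else 0).real
        ((openConn s b)ᶜ ∩ (openConn a b)ᶜ ∩ (openConn b c)ᶜ),
      (prodBernoulli fun e => if e ∈ ({s, a, b, c} : Finset V).sym2 then w e else 0).real
        ((openConn s a)ᶜ ∩ (openConn s b)ᶜ ∩ (openConn a b)ᶜ ∩ (openConn a c)ᶜ ∩ (openConn b c)ᶜ),
      (prodBernoulli fun e => if e ∈ ({s, a, b, c} : Finset V).sym2 then w e else 0).real
        ((openConn s a)ᶜ ∩ (openConn s b)ᶜ ∩ (openConn s c)ᶜ ∩ (openConn a b)ᶜ ∩ (openConn b c)ᶜ),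
      (prodBernoulli fun e => if e ∈ ({s, a, b, c} : Finset V).sym2 then w e else 0).real
        ((openConn c s)ᶜ ∩ (openConn c a)ᶜ ∩ (openConn c b)ᶜ)] := by
  suffices H : ∀ P : Finset (Sym2 V), P ⊆ ({s, a, b, c} : Finset V).sym2 →
      V4row[(prodBernoulli fun e => if e ∈ P then w e else 0).real
          ((openConn s a)ᶜ ∩ (openConn s b)ᶜ ∩ (openConn s c)ᶜ ∩ (openConn a b)ᶜ ∩ (openConn a c)ᶜ ∩ (openConn b c)ᶜ),
        (prodBernoulli fun e => if e ∈ P then w e else 0).real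
          ((openConn s b)ᶜ ∩ (openConn s c)ᶜ ∩ (openConn a b)ᶜ ∩ (openConn a c)ᶜ ∩ (openConn b c)ᶜ),
        (prodBernoulli fun e => if e ∈ P then w e else 0).real ((openConn s b)ᶜ ∩ (openConn s c)ᶜ ∩ (openConn a b)ᶜ ∩ (openConn a c)ᶜ),
        (prodBernoulli fun e => if e ∈ P then w e else 0).real
          ((openConn s a)ᶜ ∩ (openConn s b)ᶜ ∩ (openConn s c)ᶜ ∩ (openConn a b)ᶜ ∩ (openConn a c)ᶜ),
        (prodBernoulli fun e => if e ∈ P then w e else 0).real ((openConn s b)ᶜ ∩ (openConn a b)ᶜ ∩ (openConn b c)ᶜ),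
        (prodBernoulli fun e => if e ∈ P then w e else 0).real
          ((openConn s a)ᶜ ∩ (openConn s b)ᶜ ∩ (openConn a b)ᶜ ∩ (openConn a c)ᶜ ∩ (openConn b c)ᶜ),
        (prodBernoulli fun e => if e ∈ P then w e else 0).real
          ((openConn s a)ᶜ ∩ (openConn s b)ᶜ ∩ (openConn s c)ᶜ ∩ (openConn a b)ᶜ ∩ (openConn b c)ᶜ),
        (prodBernoulli fun e => if e ∈ P then w e else 0).real ((openConn c s)ᶜ ∩ (openConn c a)ᶜ ∩ (openConn c b)ᶜ)] from
    H _ (Finset.Subset.refl _)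
  intro P
  induction P using Finset.induction_on with
  | empty =>
    intro _
    have hz : (fun e : Sym2 V => if e ∈ (∅ : Finset (Sym2 V)) then w e else 0) = fun _ => (0 : unitInterval) := by
      funext e; simp
    rw [hz, ← partLE_blk0 hd, ← partLE_blk1 hd, ← partLE_blk2 hd, ← partLE_blk3 hd, ← partLE_blk4 hd, ← partLE_blk5 hd,
      ← partLE_blk6 hd, ← partLE_blk7 hd]
    simp only [real_partLE_zero]
    norm_num
  | @insert e P heP ih =>
    intro hsub
    have heT : e ∈ ({s, a, b, c} : Finset V).sym2 := hsub (Finset.mem_insert_self e P)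
    have hPT : P ⊆ ({s, a, b, c} : Finset V).sym2 := fun x hx => hsub (Finset.mem_insert_of_mem hx)
    have G1 := ih hPT
    have C1 := core_of_weight (fun e' : Sym2 V => if e' ∈ P then w e' else 0) s a b c
    have F1 := sextic_of_weight (fun e' : Sym2 V => if e' ∈ P then w e' else 0) hd
    have C2 := core_of_weight (fun e' : Sym2 V => if e' = e then w e' else 0) s a b c
    have F2 := sextic_of_weight (fun e' : Sym2 V => if e' = e then w e' else 0) hd
    have G2 := (v4_iff (fun e' : Sym2 V => if e' = e then w e' else 0) s a b c).1 (v4_single w hd e)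
    -- the three weights are terminal-only and `1 − w·1_{P ∪ {e}} = (1 − w·1_P)(1 − w·1_{e})`
    have nt : ∀ x y : V, x ∉ ({s, a, b, c} : Finset V) → s(x, y) ∉ ({s, a, b, c} : Finset V).sym2 := fun x y hx h =>
      hx (Finset.mk_mem_sym2_iff.1 h).1
    have h0 : ∀ x y : V, x ∉ ({s, a, b, c} : Finset V) → x ≠ y →
        (((fun e' : Sym2 V => if e' ∈ P then w e' else 0) s(x, y) : unitInterval) : ℝ) = 0 := by
      intro x y hx _
      have : s(x, y) ∉ P := fun h => nt x y hx (hPT h)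
      simp [this]
    have h0' : ∀ x y : V, x ∉ ({s, a, b, c} : Finset V) → x ≠ y →
        (((fun e' : Sym2 V => if e' = e then w e' else 0) s(x, y) : unitInterval) : ℝ) = 0 := by
      intro x y hx _
      have : s(x, y) ≠ e := fun h => nt x y hx (h ▸ heT)
      simp [this]
    have h0'' : ∀ x y : V, x ∉ ({s, a, b, c} : Finset V) → x ≠ y →
        (((fun e' : Sym2 V => if e' ∈ insert e P then w e' else 0) s(x, y) : unitInterval) : ℝ) = 0 := by
      intro x y hx _
      have : s(x, y) ∉ insert e P := fun h => nt x y hx (hsub h)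
      simp [this]
    have hmul : ∀ e' : Sym2 V, (1 - (((fun e' : Sym2 V => if e' ∈ insert e P then w e' else 0) e' : unitInterval) : ℝ)) =
        (1 - (((fun e' : Sym2 V => if e' ∈ P then w e' else 0) e' : unitInterval) : ℝ)) *
          (1 - (((fun e' : Sym2 V => if e' = e then w e' else 0) e' : unitInterval) : ℝ)) := by
      intro e'
      by_cases h : e' = e
      · subst h; simp [heP]
      · have : (e' ∈ insert e P) = (e' ∈ P) := by rw [Finset.mem_insert]; simp [h]
        simp [h, this]
    rw [← partLE_blk0 hd, ← partLE_blk1 hd, ← partLE_blk2 hd, ← partLE_blk3 hd, ← partLE_blk4 hd, ← partLE_blk5 hd,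
      ← partLE_blk6 hd, ← partLE_blk7 hd] at G1 C1 G2 C2 ⊢
    rw [← partLE_blk1 hd, ← partLE_blk2 hd, ← partLE_blk4 hd, ← partLE_blk7 hd] at F1 F2
    simp only [real_partLE_terminal_mul _ _ _ _ h0 h0' h0'' hmul]
    exact dvec_quartic_mul C1 G1 F1 C2 G2 F2

/-- **MAIN THEOREM (graph-level THEOREM A/B of lead gen 134): `V4` on a finite weighted graph follows from `V4` on its `{s,a,b,c}`-pieces.**
Let `s a b c` be pairwise distinct, `part : V → ι` a splitting of `w` along `{s,a,b,c}` (non-terminal pairs across labels have weight `0`), and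
suppose every split component `wᵢ := w·1_{pairs of piece i}` satisfies the super-terminal quartic law
`μᵢ(F ∩ I)⁴ ≤ μᵢ(F ∩ IA)²·μᵢ(F ∩ IB)²·μᵢ(I)` (`F = {s↔a}∩{s↮b}`, `I = c ∤ {s,a,b}`, `IA = c ∤ {s,a}`, `IB = {c↮b}`).  Then so does `w`.
Hence a counterexample to `V4` (and so, via `SuperTerminalQuarticFace.p3_half_of_superTerminalQuartic`, the first obstruction on the face route to
`P3½`/`TCB`/`TT-CHORD(E₃)`) with the fewest internal vertices is `{s,a,b,c}`-prime: "`V4` on all finite weighted graphs ⟺ `V4` on primes". [this work] -/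
theorem superTerminalQuartic_of_pieces {ι : Type*} [Fintype ι] (w : Sym2 V → unitInterval)
    (hd : s ≠ a ∧ s ≠ b ∧ s ≠ c ∧ a ≠ b ∧ a ≠ c ∧ b ≠ c) (part : V → ι)
    (hw : ∀ x y : V, x ∉ ({s, a, b, c} : Finset V) → y ∉ ({s, a, b, c} : Finset V) → part x ≠ part y → (w s(x, y) : ℝ) = 0)
    (hrow : ∀ i : ι,
      (prodBernoulli fun e => if e ∈ piecePairs {s, a, b, c} part i then w e else 0).real
          (openConn s a ∩ (openConn s b)ᶜ ∩ ((openConn c s)ᶜ ∩ (openConn c a)ᶜ ∩ (openConn c b)ᶜ) : Set (BondConfig V)) ^ 4 ≤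
      (prodBernoulli fun e => if e ∈ piecePairs {s, a, b, c} part i then w e else 0).real
          (openConn s a ∩ (openConn s b)ᶜ ∩ ((openConn c s)ᶜ ∩ (openConn c a)ᶜ) : Set (BondConfig V)) ^ 2 *
      (prodBernoulli fun e => if e ∈ piecePairs {s, a, b, c} part i then w e else 0).real
          (openConn s a ∩ (openConn s b)ᶜ ∩ (openConn c b)ᶜ : Set (BondConfig V)) ^ 2 *
      (prodBernoulli fun e => if e ∈ piecePairs {s, a, b, c} part i then w e else 0).real
          ((openConn c s)ᶜ ∩ (openConn c a)ᶜ ∩ (openConn c b)ᶜ : Set (BondConfig V))) :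
    (prodBernoulli w).real (openConn s a ∩ (openConn s b)ᶜ ∩ ((openConn c s)ᶜ ∩ (openConn c a)ᶜ ∩ (openConn c b)ᶜ) : Set (BondConfig V)) ^ 4 ≤
      (prodBernoulli w).real (openConn s a ∩ (openConn s b)ᶜ ∩ ((openConn c s)ᶜ ∩ (openConn c a)ᶜ) : Set (BondConfig V)) ^ 2 *
      (prodBernoulli w).real (openConn s a ∩ (openConn s b)ᶜ ∩ (openConn c b)ᶜ : Set (BondConfig V)) ^ 2 *
      (prodBernoulli w).real ((openConn c s)ᶜ ∩ (openConn c a)ᶜ ∩ (openConn c b)ᶜ : Set (BondConfig V)) := by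
  -- abbreviations: the terminal piece and the pieces
  set w₀ : Sym2 V → unitInterval := fun e => if e ∈ ({s, a, b, c} : Finset V).sym2 then w e else 0 with hw₀
  set wp : ι → Sym2 V → unitInterval := fun i e => if e ∈ piecePairs {s, a, b, c} part i then w e else 0 with hwp
  have G := fun i => (v4_iff (wp i) s a b c).1 (hrow i)
  have Cp := fun i => core_of_weight (wp i) s a b c
  have Fp := fun i => sextic_of_weight (wp i) hd
  -- induction over sets of pieces: the vector `D(w₀) · ∏_{i ∈ S} D(wᵢ)` (= `D(w_S)`) satisfies the row
  have key : ∀ S : Finset ι,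
      V4row[
        (prodBernoulli w₀).real ((openConn s a)ᶜ ∩ (openConn s b)ᶜ ∩ (openConn s c)ᶜ ∩ (openConn a b)ᶜ ∩ (openConn a c)ᶜ ∩ (openConn b c)ᶜ) *
          ∏ i ∈ S, (prodBernoulli (wp i)).real ((openConn s a)ᶜ ∩ (openConn s b)ᶜ ∩ (openConn s c)ᶜ ∩ (openConn a b)ᶜ ∩ (openConn a c)ᶜ ∩ (openConn b c)ᶜ),
        (prodBernoulli w₀).real ((openConn s b)ᶜ ∩ (openConn s c)ᶜ ∩ (openConn a b)ᶜ ∩ (openConn a c)ᶜ ∩ (openConn b c)ᶜ) *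
          ∏ i ∈ S, (prodBernoulli (wp i)).real ((openConn s b)ᶜ ∩ (openConn s c)ᶜ ∩ (openConn a b)ᶜ ∩ (openConn a c)ᶜ ∩ (openConn b c)ᶜ),
        (prodBernoulli w₀).real ((openConn s b)ᶜ ∩ (openConn s c)ᶜ ∩ (openConn a b)ᶜ ∩ (openConn a c)ᶜ) *
          ∏ i ∈ S, (prodBernoulli (wp i)).real ((openConn s b)ᶜ ∩ (openConn s c)ᶜ ∩ (openConn a b)ᶜ ∩ (openConn a c)ᶜ),
        (prodBernoulli w₀).real ((openConn s a)ᶜ ∩ (openConn s b)ᶜ ∩ (openConn s c)ᶜ ∩ (openConn a b)ᶜ ∩ (openConn a c)ᶜ) *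
          ∏ i ∈ S, (prodBernoulli (wp i)).real ((openConn s a)ᶜ ∩ (openConn s b)ᶜ ∩ (openConn s c)ᶜ ∩ (openConn a b)ᶜ ∩ (openConn a c)ᶜ),
        (prodBernoulli w₀).real ((openConn s b)ᶜ ∩ (openConn a b)ᶜ ∩ (openConn b c)ᶜ) *
          ∏ i ∈ S, (prodBernoulli (wp i)).real ((openConn s b)ᶜ ∩ (openConn a b)ᶜ ∩ (openConn b c)ᶜ),
        (prodBernoulli w₀).real ((openConn s a)ᶜ ∩ (openConn s b)ᶜ ∩ (openConn a b)ᶜ ∩ (openConn a c)ᶜ ∩ (openConn b c)ᶜ) *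
          ∏ i ∈ S, (prodBernoulli (wp i)).real ((openConn s a)ᶜ ∩ (openConn s b)ᶜ ∩ (openConn a b)ᶜ ∩ (openConn a c)ᶜ ∩ (openConn b c)ᶜ),
        (prodBernoulli w₀).real ((openConn s a)ᶜ ∩ (openConn s b)ᶜ ∩ (openConn s c)ᶜ ∩ (openConn a b)ᶜ ∩ (openConn b c)ᶜ) *
          ∏ i ∈ S, (prodBernoulli (wp i)).real ((openConn s a)ᶜ ∩ (openConn s b)ᶜ ∩ (openConn s c)ᶜ ∩ (openConn a b)ᶜ ∩ (openConn b c)ᶜ),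
        (prodBernoulli w₀).real ((openConn c s)ᶜ ∩ (openConn c a)ᶜ ∩ (openConn c b)ᶜ) *
          ∏ i ∈ S, (prodBernoulli (wp i)).real ((openConn c s)ᶜ ∩ (openConn c a)ᶜ ∩ (openConn c b)ᶜ)] := by
    intro S
    induction S using Finset.induction_on with
    | empty =>
      simp only [Finset.prod_empty, mul_one]
      exact v4_terminal w hd
    | @insert j S hj ih =>
      -- the partial union `w_S` is a weighted graph: order relations and face inequality for `D(w₀)·∏_{i∈S} D(wᵢ)`
      have pu := fun blk : V → ℕ => real_partLE_partialUnion w ({s, a, b, c} : Finset V) part hw S blk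
      have CS := core_of_weight (fun e => if e ∈ ({s, a, b, c} : Finset V).sym2 ∨ ∃ i ∈ S, e ∈ piecePairs {s, a, b, c} part i
        then w e else 0) s a b c
      have FS := sextic_of_weight (fun e => if e ∈ ({s, a, b, c} : Finset V).sym2 ∨ ∃ i ∈ S, e ∈ piecePairs {s, a, b, c} part i
        then w e else 0) hd
      rw [← partLE_blk0 hd, ← partLE_blk1 hd, ← partLE_blk2 hd, ← partLE_blk3 hd, ← partLE_blk4 hd, ← partLE_blk5 hd,
        ← partLE_blk6 hd, ← partLE_blk7 hd] at CS
      rw [← partLE_blk1 hd, ← partLE_blk2 hd, ← partLE_blk4 hd, ← partLE_blk7 hd] at FS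
      simp only [pu] at CS FS
      rw [partLE_blk0 hd, partLE_blk1 hd, partLE_blk2 hd, partLE_blk3 hd, partLE_blk4 hd, partLE_blk5 hd, partLE_blk6 hd,
        partLE_blk7 hd] at CS
      rw [partLE_blk1 hd, partLE_blk2 hd, partLE_blk4 hd, partLE_blk7 hd] at FS
      have step := dvec_quartic_mul CS ih FS (Cp j) (G j) (Fp j)
      have r : ∀ (x : ℝ) (y : ι → ℝ), x * ∏ i ∈ insert j S, y i = x * (∏ i ∈ S, y i) * y j := fun x y => by
        rw [Finset.prod_insert hj]; ring
      simp only [r]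
      exact step
  -- at `S = univ` the vector is `D(w)` by the splitting formula
  have K := key Finset.univ
  have S0 := real_partLE_eq_terminalPiece_mul_prod w ({s, a, b, c} : Finset V) part
    (fun v => if v = a then 1 else if v = b then 2 else if v = c then 3 else (0 : ℕ)) hw
  have S1 := real_partLE_eq_terminalPiece_mul_prod w ({s, a, b, c} : Finset V) part
    (fun v => if v = b then 1 else if v = c then 2 else (0 : ℕ)) hw
  have S2 := real_partLE_eq_terminalPiece_mul_prod w ({s, a, b, c} : Finset V) part
    (fun v => if v = b ∨ v = c then 1 else (0 : ℕ)) hw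
  have S3 := real_partLE_eq_terminalPiece_mul_prod w ({s, a, b, c} : Finset V) part
    (fun v => if v = a then 1 else if v = b ∨ v = c then 2 else (0 : ℕ)) hw
  have S4 := real_partLE_eq_terminalPiece_mul_prod w ({s, a, b, c} : Finset V) part
    (fun v => if v = b then 1 else (0 : ℕ)) hw
  have S5 := real_partLE_eq_terminalPiece_mul_prod w ({s, a, b, c} : Finset V) part
    (fun v => if v = a then 1 else if v = b then 2 else (0 : ℕ)) hw
  have S6 := real_partLE_eq_terminalPiece_mul_prod w ({s, a, b, c} : Finset V) part
    (fun v => if v = a ∨ v = c then 1 else if v = b then 2 else (0 : ℕ)) hw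
  have S7 := real_partLE_eq_terminalPiece_mul_prod w ({s, a, b, c} : Finset V) part
    (fun v => if v = c then 1 else (0 : ℕ)) hw
  rw [partLE_blk0 hd] at S0
  rw [partLE_blk1 hd] at S1
  rw [partLE_blk2 hd] at S2
  rw [partLE_blk3 hd] at S3
  rw [partLE_blk4 hd] at S4
  rw [partLE_blk5 hd] at S5
  rw [partLE_blk6 hd] at S6
  rw [partLE_blk7 hd] at S7
  rw [← S0, ← S1, ← S2, ← S3, ← S4, ← S5, ← S6, ← S7] at K
  exact (v4_iff w s a b c).2 K

/-- **`superTerminalQuartic_of_pieces` with caller-supplied decidability instances** (e.g. `V = Fin n`, `ι = Fin k` or a type of connected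
components): the same statement, the instances hidden in `{s,a,b,c}` / `piecePairs` being those in scope at the call site. [this work] -/
theorem superTerminalQuartic_of_pieces' [DecidableEq V] {ι : Type*} [Fintype ι] [DecidableEq ι] (w : Sym2 V → unitInterval)
    (hd : s ≠ a ∧ s ≠ b ∧ s ≠ c ∧ a ≠ b ∧ a ≠ c ∧ b ≠ c) (part : V → ι)
    (hw : ∀ x y : V, x ∉ ({s, a, b, c} : Finset V) → y ∉ ({s, a, b, c} : Finset V) → part x ≠ part y → (w s(x, y) : ℝ) = 0)
    (hrow : ∀ i : ι,
      (prodBernoulli fun e => if e ∈ piecePairs {s, a, b, c} part i then w e else 0).real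
          (openConn s a ∩ (openConn s b)ᶜ ∩ ((openConn c s)ᶜ ∩ (openConn c a)ᶜ ∩ (openConn c b)ᶜ) : Set (BondConfig V)) ^ 4 ≤
      (prodBernoulli fun e => if e ∈ piecePairs {s, a, b, c} part i then w e else 0).real
          (openConn s a ∩ (openConn s b)ᶜ ∩ ((openConn c s)ᶜ ∩ (openConn c a)ᶜ) : Set (BondConfig V)) ^ 2 *
      (prodBernoulli fun e => if e ∈ piecePairs {s, a, b, c} part i then w e else 0).real
          (openConn s a ∩ (openConn s b)ᶜ ∩ (openConn c b)ᶜ : Set (BondConfig V)) ^ 2 *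
      (prodBernoulli fun e => if e ∈ piecePairs {s, a, b, c} part i then w e else 0).real
          ((openConn c s)ᶜ ∩ (openConn c a)ᶜ ∩ (openConn c b)ᶜ : Set (BondConfig V))) :
    (prodBernoulli w).real (openConn s a ∩ (openConn s b)ᶜ ∩ ((openConn c s)ᶜ ∩ (openConn c a)ᶜ ∩ (openConn c b)ᶜ) : Set (BondConfig V)) ^ 4 ≤
      (prodBernoulli w).real (openConn s a ∩ (openConn s b)ᶜ ∩ ((openConn c s)ᶜ ∩ (openConn c a)ᶜ) : Set (BondConfig V)) ^ 2 *
      (prodBernoulli w).real (openConn s a ∩ (openConn s b)ᶜ ∩ (openConn c b)ᶜ : Set (BondConfig V)) ^ 2 *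
      (prodBernoulli w).real ((openConn c s)ᶜ ∩ (openConn c a)ᶜ ∩ (openConn c b)ᶜ : Set (BondConfig V)) := by
  obtain rfl : ‹DecidableEq V› = fun a b => Classical.propDecidable (a = b) := Subsingleton.elim _ _
  obtain rfl : ‹DecidableEq ι› = fun a b => Classical.propDecidable (a = b) := Subsingleton.elim _ _
  exact superTerminalQuartic_of_pieces w hd part hw hrow

/-- **Reduction of `V4` to `{s,a,b,c}`-PRIME weighted graphs.**  Call a weight `u` on `V` prime (for the terminals `s,a,b,c`) if it vanishes on
the six terminal pairs and its ACTIVE non-terminal vertices (those on a pair of non-zero weight) are pairwise joined by paths of non-terminal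
vertices along pairs of non-zero weight — one internal component, no terminal–terminal edge.  If `V4` holds for every prime restriction `u` of `w`
(`u = w` on the support of `u`), then `V4` holds for `w`: apply `superTerminalQuartic_of_pieces` to the labelling of `V` by the connected components of the graph
of non-zero non-terminal pairs of `w`; each piece weight `w·1_{pairs of piece i}` is prime.  Hence a counterexample to `V4` with the fewest active vertices is prime. [this work] -/
theorem superTerminalQuartic_of_primes (w : Sym2 V → unitInterval) (hd : s ≠ a ∧ s ≠ b ∧ s ≠ c ∧ a ≠ b ∧ a ≠ c ∧ b ≠ c)
    (hprime : ∀ u : Sym2 V → unitInterval,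
      (∀ e, (u e : ℝ) ≠ 0 → u e = w e) →
      (∀ x y : V, (x = s ∨ x = a ∨ x = b ∨ x = c) → (y = s ∨ y = a ∨ y = b ∨ y = c) → (u s(x, y) : ℝ) = 0) →
      (∀ x y : V, ¬ (x = s ∨ x = a ∨ x = b ∨ x = c) → ¬ (y = s ∨ y = a ∨ y = b ∨ y = c) →
        (∃ z, (u s(x, z) : ℝ) ≠ 0) → (∃ z, (u s(y, z) : ℝ) ≠ 0) →
        (SimpleGraph.fromRel fun p q : V =>
            ¬ (p = s ∨ p = a ∨ p = b ∨ p = c) ∧ ¬ (q = s ∨ q = a ∨ q = b ∨ q = c) ∧ (u s(p, q) : ℝ) ≠ 0).Reachable x y) →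
      (prodBernoulli u).real (openConn s a ∩ (openConn s b)ᶜ ∩ ((openConn c s)ᶜ ∩ (openConn c a)ᶜ ∩ (openConn c b)ᶜ) : Set (BondConfig V)) ^ 4 ≤
        (prodBernoulli u).real (openConn s a ∩ (openConn s b)ᶜ ∩ ((openConn c s)ᶜ ∩ (openConn c a)ᶜ) : Set (BondConfig V)) ^ 2 *
        (prodBernoulli u).real (openConn s a ∩ (openConn s b)ᶜ ∩ (openConn c b)ᶜ : Set (BondConfig V)) ^ 2 *
        (prodBernoulli u).real ((openConn c s)ᶜ ∩ (openConn c a)ᶜ ∩ (openConn c b)ᶜ : Set (BondConfig V))) :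
    (prodBernoulli w).real (openConn s a ∩ (openConn s b)ᶜ ∩ ((openConn c s)ᶜ ∩ (openConn c a)ᶜ ∩ (openConn c b)ᶜ) : Set (BondConfig V)) ^ 4 ≤
      (prodBernoulli w).real (openConn s a ∩ (openConn s b)ᶜ ∩ ((openConn c s)ᶜ ∩ (openConn c a)ᶜ) : Set (BondConfig V)) ^ 2 *
      (prodBernoulli w).real (openConn s a ∩ (openConn s b)ᶜ ∩ (openConn c b)ᶜ : Set (BondConfig V)) ^ 2 *
      (prodBernoulli w).real ((openConn c s)ᶜ ∩ (openConn c a)ᶜ ∩ (openConn c b)ᶜ : Set (BondConfig V)) := by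
  -- the terminal set and the graph of non-zero non-terminal pairs
  have hT : ∀ x : V, x ∈ ({s, a, b, c} : Finset V) ↔ (x = s ∨ x = a ∨ x = b ∨ x = c) := fun x => by
    simp only [Finset.mem_insert, Finset.mem_singleton]
  set H : SimpleGraph V := SimpleGraph.fromRel fun p q : V =>
      ¬ (p = s ∨ p = a ∨ p = b ∨ p = c) ∧ ¬ (q = s ∨ q = a ∨ q = b ∨ q = c) ∧ (w s(p, q) : ℝ) ≠ 0 with hH
  haveI : Fintype H.ConnectedComponent := Fintype.ofFinite _
  refine superTerminalQuartic_of_pieces w hd (fun v => H.connectedComponentMk v) ?_ ?_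
  · -- splitting: non-terminals in different components span a weight-zero pair
    intro x y hx hy hxy
    by_contra hne
    apply hxy
    rw [SimpleGraph.ConnectedComponent.eq]
    by_cases hxy' : x = y
    · subst hxy'; rfl
    refine SimpleGraph.Adj.reachable ?_
    rw [hH, SimpleGraph.fromRel_adj]
    exact ⟨hxy', Or.inl ⟨fun h => hx ((hT x).2 h), fun h => hy ((hT y).2 h), hne⟩⟩
  · -- every piece weight is prime
    intro i
    apply hprime
    · intro e he
      by_cases h : e ∈ piecePairs {s, a, b, c} (fun v => H.connectedComponentMk v) i
      · simp [h]
      · exfalso; apply he; simp [h]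
    · intro x y hx hy
      have : s(x, y) ∉ piecePairs {s, a, b, c} (fun v => H.connectedComponentMk v) i :=
        termPair_not_mem_piecePairs ((hT x).2 hx) ((hT y).2 hy)
      simp [this]
    · intro x y hx hy hxz hyz
      -- an active non-terminal of piece `i` lies in the component `i`
      have act : ∀ v : V, ¬ (v = s ∨ v = a ∨ v = b ∨ v = c) →
          (∃ z, ((fun e => if e ∈ piecePairs {s, a, b, c} (fun v => H.connectedComponentMk v) i then w e else 0) s(v, z) : ℝ) ≠ 0) →
          H.connectedComponentMk v = i := by
        rintro v hv ⟨z, hz⟩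
        by_cases hmem : s(v, z) ∈ piecePairs {s, a, b, c} (fun v => H.connectedComponentMk v) i
        · obtain ⟨p, q, ⟨hp, hpi⟩, hq, -, hpq⟩ := mem_piecePairs.1 hmem
          rcases Sym2.eq_iff.1 hpq with ⟨rfl, -⟩ | ⟨rfl, rfl⟩
          · exact hpi
          · rcases hq with ⟨-, hqi⟩ | hq
            · exact hqi
            · exact (hv ((hT _).1 hq)).elim
        · exact (hz (by simp [hmem])).elim
      have hxi := act x hx hxz
      have hyi := act y hy hyz
      have hreach : H.Reachable x y := SimpleGraph.ConnectedComponent.eq.1 (hxi.trans hyi.symm)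
      -- transport an `H`-walk inside the component `i` to the graph of the piece weight
      obtain ⟨p⟩ := hreach
      suffices key : ∀ {x' y' : V} (q : H.Walk x' y'), H.connectedComponentMk x' = i →
          (SimpleGraph.fromRel fun p q : V => ¬ (p = s ∨ p = a ∨ p = b ∨ p = c) ∧ ¬ (q = s ∨ q = a ∨ q = b ∨ q = c) ∧
            ((fun e => if e ∈ piecePairs {s, a, b, c} (fun v => H.connectedComponentMk v) i then w e else 0) s(p, q) : ℝ) ≠ 0).Reachable x' y' from
        key p hxi
      intro x' y' q
      induction q with
      | nil => exact fun _ => SimpleGraph.Reachable.refl _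
      | @cons u v _ hadj _ ih =>
        intro hui
        have hadj' := hadj
        rw [hH, SimpleGraph.fromRel_adj] at hadj'
        obtain ⟨huv, hrel⟩ := hadj'
        have hvi : H.connectedComponentMk v = i := by
          rw [← hui]; exact (SimpleGraph.ConnectedComponent.eq.2 (SimpleGraph.Adj.reachable hadj)).symm
        have hu' : ¬ (u = s ∨ u = a ∨ u = b ∨ u = c) := by rcases hrel with ⟨h, -, -⟩ | ⟨-, h, -⟩ <;> exact h
        have hv' : ¬ (v = s ∨ v = a ∨ v = b ∨ v = c) := by rcases hrel with ⟨-, h, -⟩ | ⟨h, -, -⟩ <;> exact h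
        have hw0 : (w s(u, v) : ℝ) ≠ 0 := by
          rcases hrel with ⟨-, -, h⟩ | ⟨-, -, h⟩
          · exact h
          · rw [Sym2.eq_swap]; exact h
        have hmem : s(u, v) ∈ piecePairs {s, a, b, c} (fun v => H.connectedComponentMk v) i :=
          mk_mem_piecePairs (fun h => hu' ((hT u).1 h)) hui (Or.inl ⟨fun h => hv' ((hT v).1 h), hvi⟩) huv
        refine SimpleGraph.Reachable.trans (SimpleGraph.Adj.reachable ?_) (ih hvi)
        rw [SimpleGraph.fromRel_adj]
        refine ⟨huv, Or.inl ⟨hu', hv', ?_⟩⟩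
        simp only [hmem, if_true]
        exact hw0


end Pieces

end Summit.CriticalPhenomena.PercolationContinuityZ3.Theorems.SuperTerminalQuarticGluing
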